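import Literature.AnabelianGeometry.SemiGraphs.BTempPullbackOrbit
import Literature.AnabelianGeometry.SemiGraphs.CoveringProducts
import Literature.AlgebraicGeometry.Frobenioids.QuasiTemperoidConnectedPart
import HarnessLib

/-!
# `B^temp(Π)`: point-level toolkit for pullback cones, terminal objects and coequalizers of
# equivalence relations (input of the Čech-route proof of [SemiAnbd] Theorem A.4)

Mochizuki, *Semi-graphs of anabelioids*, Publ. RIMS **42** (2006), Appendix, Theorem A.4 (manuscript
pp. 82–86) [cite: MochizukiSemiAnbd2006, Thm A.4 pp.82-86].  Row A4-∃ / file E3a of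
`plan/L3/SUBDAG-SemiAnbd-Cor311.md` (holder abc-iut-w5-d129): the finite-limit preservation of the
Čech extension `ψ^*(X) := coeq(F(X×A×A) ⇉ F(X×A))` is checked ON POINTS in `B^temp(Π₁)`; this file
supplies the elementary dictionary between Mathlib (co)limit cones in `B^temp(Π)` and points:

* §1 `BTemp.isLimit_pullbackObj` — the explicit fibre product `X ×_Z Y` of `BTempPullbackOrbit.lean`
  IS a pullback (the `IsLimit` d081's audit note N1 asked for); for ANY limit pullback cone:
  `exists_point_of_isLimit_pullbackCone'` / `point_ext_of_isLimit_pullbackCone` (points ↔ compatible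
  pairs), and conversely `isLimit_pullbackCone_of_bijective`;
* §2 terminal objects: `isTerminal_of_unique` (one point ⇒ terminal), `subsingleton_of_isTerminal` /
  `nonempty_of_isTerminal`;
* §4 binary fans: `point_ext_of_isLimit_binaryFan` / `exists_point_of_isLimit_binaryFan'` (over the
  explicit product `BTemp.prodObj` of `CoveringProducts.lean`, here given its projections and
  `isLimit_prodObj`).

(The companion point-level description of COEQUALIZERS is abc-iut-w4-d081's
`BTempCoequalizerPoints.lean`: `BTemp.cofork_π_surjective`, `cofork_π_apply_eq_iff_of_equivalence`.)

Elementary `Π`-set theory (`Π` any topological group); nothing takes a side on [IUTchIII] Cor. 3.12.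
-/

namespace Literature.AnabelianGeometry.SemiGraphs

open CategoryTheory CategoryTheory.Limits
open Literature.AlgebraicGeometry.Frobenioids.QuasiTemperoid.BTempConnected (hom_ρ hom_ext_apply
  ρ_one_apply ρ_mul_apply isIso_of_bijective)

universe u

namespace BTemp

variable {G : Type u} [Group G] [TopologicalSpace G]

/-! ### §1 Pullback cones and points -/

section Pullback

variable {X Y Z : BTemp G} (f : X ⟶ Z) (g : Y ⟶ Z)

/-- **The explicit fibre product is a pullback**: `X ×_Z Y` (pairs `(x, y)` with `f x = g y`) with
its two projections is a limit pullback cone of `B^temp(Π)` — lift a cone `W` by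
`w ↦ (fst w, snd w)`. [cite: MochizukiSemiAnbd2006, Thm A.4 pp.82-86] -/
noncomputable def isLimit_pullbackObj :
    IsLimit (PullbackCone.mk (pullbackFst f g) (pullbackSnd f g) (pullback_condition f g)) :=
  PullbackCone.IsLimit.mk _
    (fun s => ObjectProperty.homMk
      { hom := TypeCat.ofHom fun w => pullbackPt f g (s.fst.hom.hom w) (s.snd.hom.hom w)
          (by
            change ((s.fst ≫ f).hom.hom w : Z.obj.V) = (s.snd ≫ g).hom.hom w
            rw [s.condition])
        comm := fun a => by
          refine ConcreteCategory.hom_ext _ _ fun w => pullbackObj_ext f g ?_ ?_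
          · exact hom_ρ s.fst a w
          · exact hom_ρ s.snd a w })
    (fun s => hom_ext_apply fun _ => rfl)
    (fun s => hom_ext_apply fun _ => rfl)
    (fun s m h₁ h₂ => hom_ext_apply fun w => pullbackObj_ext f g
      (congrArg (fun φ : s.pt ⟶ X => (φ.hom.hom w : X.obj.V)) h₁)
      (congrArg (fun φ : s.pt ⟶ Y => (φ.hom.hom w : Y.obj.V)) h₂))

variable {f g}

/-- **Points of ANY limit pullback cone are the compatible pairs — existence**: if `c` is a limit
pullback cone over `X → Z ← Y`, every pair `(x, y)` with `f x = g y` is `(fst w, snd w)` for some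
point `w`. [cite: MochizukiSemiAnbd2006, Thm A.4 pp.82-86] -/
theorem exists_point_of_isLimit_pullbackCone' {c : PullbackCone f g} (hc : IsLimit c) (x : X.obj.V)
    (y : Y.obj.V) (h : (f.hom.hom x : Z.obj.V) = g.hom.hom y) :
    ∃ w : c.pt.obj.V, (c.fst.hom.hom w : X.obj.V) = x ∧ (c.snd.hom.hom w : Y.obj.V) = y := by
  -- compare with the explicit fibre product
  let e : c.pt ≅ pullbackObj f g :=
    hc.conePointUniqueUpToIso (isLimit_pullbackObj f g)
  have h₁ : e.inv ≫ c.fst = pullbackFst f g :=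
    hc.conePointUniqueUpToIso_inv_comp (isLimit_pullbackObj f g) WalkingCospan.left
  have h₂ : e.inv ≫ c.snd = pullbackSnd f g :=
    hc.conePointUniqueUpToIso_inv_comp (isLimit_pullbackObj f g) WalkingCospan.right
  refine ⟨e.inv.hom.hom (pullbackPt f g x y h), ?_, ?_⟩
  · exact congrArg (fun φ : pullbackObj f g ⟶ X => (φ.hom.hom (pullbackPt f g x y h) : X.obj.V)) h₁
  · exact congrArg (fun φ : pullbackObj f g ⟶ Y => (φ.hom.hom (pullbackPt f g x y h) : Y.obj.V)) h₂

/-- **Points of ANY limit pullback cone are the compatible pairs — uniqueness**: two points with the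
same two projections are equal. [cite: MochizukiSemiAnbd2006, Thm A.4 pp.82-86] -/
theorem point_ext_of_isLimit_pullbackCone {c : PullbackCone f g} (hc : IsLimit c) {w w' : c.pt.obj.V}
    (h₁ : (c.fst.hom.hom w : X.obj.V) = c.fst.hom.hom w')
    (h₂ : (c.snd.hom.hom w : Y.obj.V) = c.snd.hom.hom w') : w = w' := by
  let e : c.pt ≅ pullbackObj f g :=
    hc.conePointUniqueUpToIso (isLimit_pullbackObj f g)
  have hf : e.hom ≫ pullbackFst f g = c.fst :=
    hc.conePointUniqueUpToIso_hom_comp (isLimit_pullbackObj f g) WalkingCospan.left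
  have hs : e.hom ≫ pullbackSnd f g = c.snd :=
    hc.conePointUniqueUpToIso_hom_comp (isLimit_pullbackObj f g) WalkingCospan.right
  have hinj : Function.Injective fun v : c.pt.obj.V => (e.hom.hom.hom v : (pullbackObj f g).obj.V) :=
    Function.LeftInverse.injective (g := fun p => (e.inv.hom.hom p : c.pt.obj.V)) fun v => by
      change ((e.hom ≫ e.inv).hom.hom v : c.pt.obj.V) = v
      rw [e.hom_inv_id]
      rfl
  apply hinj
  apply pullbackObj_ext f g
  · change ((e.hom ≫ pullbackFst f g).hom.hom w : X.obj.V) = (e.hom ≫ pullbackFst f g).hom.hom w'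
    rw [hf]
    exact h₁
  · change ((e.hom ≫ pullbackSnd f g).hom.hom w : Y.obj.V) = (e.hom ≫ pullbackSnd f g).hom.hom w'
    rw [hs]
    exact h₂

/-- **A pullback cone is a limit as soon as its points are exactly the compatible pairs**: if
`w ↦ (fst w, snd w)` is a bijection onto `{(x, y) | f x = g y}`, the cone is a limit (lift pointwise
through the inverse bijection; equivariance is forced by injectivity).
[cite: MochizukiSemiAnbd2006, Thm A.4 pp.82-86] -/
theorem isLimit_pullbackCone_of_bijective (c : PullbackCone f g)
    (hinj : ∀ w w' : c.pt.obj.V, (c.fst.hom.hom w : X.obj.V) = c.fst.hom.hom w' →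
      (c.snd.hom.hom w : Y.obj.V) = c.snd.hom.hom w' → w = w')
    (hsurj : ∀ (x : X.obj.V) (y : Y.obj.V), (f.hom.hom x : Z.obj.V) = g.hom.hom y →
      ∃ w : c.pt.obj.V, (c.fst.hom.hom w : X.obj.V) = x ∧ (c.snd.hom.hom w : Y.obj.V) = y) :
    Nonempty (IsLimit c) := by
  classical
  -- the comparison map to the explicit fibre product is a bijection, hence an isomorphism
  let φ : c.pt ⟶ pullbackObj f g := ObjectProperty.homMk
    { hom := TypeCat.ofHom fun w => pullbackPt f g (c.fst.hom.hom w) (c.snd.hom.hom w) (by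
          change ((c.fst ≫ f).hom.hom w : Z.obj.V) = (c.snd ≫ g).hom.hom w
          rw [c.condition])
      comm := fun a => by
        refine ConcreteCategory.hom_ext _ _ fun w => pullbackObj_ext f g ?_ ?_
        · exact hom_ρ c.fst a w
        · exact hom_ρ c.snd a w }
  have hφ : Function.Bijective fun w : c.pt.obj.V => (φ.hom.hom w : (pullbackObj f g).obj.V) := by
    constructor
    · intro w w' h
      have h' := congrArg Subtype.val h
      exact hinj w w' (congrArg Prod.fst h') (congrArg Prod.snd h')
    · rintro ⟨⟨x, y⟩, hxy⟩
      obtain ⟨w, hw₁, hw₂⟩ := hsurj x y hxy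
      exact ⟨w, pullbackObj_ext f g hw₁ hw₂⟩
  haveI : IsIso φ := isIso_of_bijective φ hφ
  have hφ₁ : φ ≫ pullbackFst f g = c.fst := hom_ext_apply fun _ => rfl
  have hφ₂ : φ ≫ pullbackSnd f g = c.snd := hom_ext_apply fun _ => rfl
  -- transport the limit structure along the cone isomorphism
  let e : c.pt ≅ pullbackObj f g := asIso φ
  have he : e.hom = φ := rfl
  let i : c ≅ PullbackCone.mk (pullbackFst f g) (pullbackSnd f g) (pullback_condition f g) :=
    PullbackCone.ext e (by rw [PullbackCone.mk_fst, he]; exact hφ₁.symm)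
      (by rw [PullbackCone.mk_snd, he]; exact hφ₂.symm)
  exact ⟨IsLimit.ofIsoLimit (isLimit_pullbackObj f g) i.symm⟩

end Pullback

/-! ### §2 Terminal objects and points -/

section Terminal

/-- The one-point object with trivial action. [cite: MochizukiSemiAnbd2006, Thm A.4 pp.82-86] -/
def punitObj : BTemp G :=
  ⟨{ V := PUnit.{u + 1}, ρ := 1 }, ⟨inferInstance, fun _ => by
    have : {g : G | (1 : G →* End (PUnit : Type u)) g PUnit.unit = PUnit.unit} = Set.univ :=
      Set.eq_univ_of_forall fun _ => rfl
    rw [this]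
    exact isOpen_univ⟩⟩

/-- **An object with exactly one point is terminal** (the constant map into it is equivariant and
unique). [cite: MochizukiSemiAnbd2006, Thm A.4 pp.82-86] -/
def isTerminal_of_unique (T : BTemp G) (t₀ : T.obj.V) (ht : ∀ t : T.obj.V, t = t₀) : IsTerminal T :=
  IsTerminal.ofUniqueHom
    (fun Y => ObjectProperty.homMk
      { hom := TypeCat.ofHom fun _ => t₀
        comm := fun a => by
          refine ConcreteCategory.hom_ext _ _ fun _ => ?_
          exact (ht (T.obj.ρ a t₀)).symm })
    (fun Y m => hom_ext_apply fun y => ht _)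

/-- The one-point object is terminal. [cite: MochizukiSemiAnbd2006, Thm A.4 pp.82-86] -/
def isTerminal_punitObj : IsTerminal (punitObj : BTemp G) :=
  isTerminal_of_unique punitObj PUnit.unit fun _ => rfl

/-- **A terminal object of `B^temp(Π)` has exactly one point** (it is isomorphic to the one-point
object). [cite: MochizukiSemiAnbd2006, Thm A.4 pp.82-86] -/
theorem subsingleton_of_isTerminal {T : BTemp G} (hT : IsTerminal T) (t t' : T.obj.V) : t = t' := by
  let e : T ≅ punitObj := hT.uniqueUpToIso isTerminal_punitObj
  have hinj : Function.Injective fun s : T.obj.V => (e.hom.hom.hom s : (punitObj : BTemp G).obj.V) :=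
    Function.LeftInverse.injective (g := fun p => (e.inv.hom.hom p : T.obj.V)) fun s => by
      change ((e.hom ≫ e.inv).hom.hom s : T.obj.V) = s
      rw [e.hom_inv_id]
      rfl
  exact hinj rfl

/-- A terminal object of `B^temp(Π)` has a point. [cite: MochizukiSemiAnbd2006, Thm A.4 pp.82-86] -/
theorem nonempty_of_isTerminal {T : BTemp G} (hT : IsTerminal T) : Nonempty T.obj.V :=
  ⟨(hT.uniqueUpToIso isTerminal_punitObj).inv.hom.hom PUnit.unit⟩

/-- A morphism between one-point objects is an isomorphism. [cite: MochizukiSemiAnbd2006, Thm A.4 pp.82-86] -/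
theorem isIso_of_unique_of_unique {S T : BTemp G} (φ : S ⟶ T) (s₀ : S.obj.V) (hS : ∀ s, s = s₀)
    (hT : ∀ t t' : T.obj.V, t = t') : IsIso φ :=
  isIso_of_bijective φ ⟨fun s s' _ => (hS s).trans (hS s').symm, fun _ => ⟨s₀, hT _ _⟩⟩

end Terminal


/-! ### §4 Binary fans and points -/

section BinaryFan

variable (X Y : BTemp G)

/-- First projection of the explicit product `BTemp.prodObj` (pairs, diagonal action;
`CoveringProducts.lean`). [cite: MochizukiSemiAnbd2006, Thm A.4 pp.82-86] -/
def prodObjFst : prodObj X Y ⟶ X :=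
  ObjectProperty.homMk { hom := TypeCat.ofHom fun p => p.1, comm := fun _ => rfl }

/-- Second projection of the explicit product. [cite: MochizukiSemiAnbd2006, Thm A.4 pp.82-86] -/
def prodObjSnd : prodObj X Y ⟶ Y :=
  ObjectProperty.homMk { hom := TypeCat.ofHom fun p => p.2, comm := fun _ => rfl }

/-- **The explicit product is a product** (lift pointwise). [cite: MochizukiSemiAnbd2006, Thm A.4 pp.82-86] -/
noncomputable def isLimit_prodObj : IsLimit (BinaryFan.mk (prodObjFst X Y) (prodObjSnd X Y)) :=
  BinaryFan.IsLimit.mk _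
    (fun {W} u v => ObjectProperty.homMk
      { hom := TypeCat.ofHom fun w => ((u.hom.hom w : X.obj.V), (v.hom.hom w : Y.obj.V))
        comm := fun a => by
          apply ConcreteCategory.hom_ext
          intro w
          exact Prod.ext (hom_ρ u a w) (hom_ρ v a w) })
    (fun u v => hom_ext_apply fun _ => rfl)
    (fun u v => hom_ext_apply fun _ => rfl)
    (fun u v m h₁ h₂ => hom_ext_apply fun w => Prod.ext
      (congrArg (fun φ => (φ.hom.hom w : X.obj.V)) h₁)
      (congrArg (fun φ => (φ.hom.hom w : Y.obj.V)) h₂))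

variable {X Y}

/-- **Points of ANY limit binary fan are determined by their two projections.**
[cite: MochizukiSemiAnbd2006, Thm A.4 pp.82-86] -/
theorem point_ext_of_isLimit_binaryFan {P : BTemp G} {fst : P ⟶ X} {snd : P ⟶ Y}
    (hP : IsLimit (BinaryFan.mk fst snd)) {p p' : P.obj.V}
    (h₁ : (fst.hom.hom p : X.obj.V) = fst.hom.hom p') (h₂ : (snd.hom.hom p : Y.obj.V) = snd.hom.hom p') :
    p = p' := by
  let e : P ≅ prodObj X Y := hP.conePointUniqueUpToIso (isLimit_prodObj X Y)
  have hf : e.hom ≫ prodObjFst X Y = fst :=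
    hP.conePointUniqueUpToIso_hom_comp (isLimit_prodObj X Y) ⟨WalkingPair.left⟩
  have hs : e.hom ≫ prodObjSnd X Y = snd :=
    hP.conePointUniqueUpToIso_hom_comp (isLimit_prodObj X Y) ⟨WalkingPair.right⟩
  have hinj : Function.Injective fun v : P.obj.V => (e.hom.hom.hom v : (prodObj X Y).obj.V) :=
    Function.LeftInverse.injective (g := fun q => (e.inv.hom.hom q : P.obj.V)) fun v => by
      change ((e.hom ≫ e.inv).hom.hom v : P.obj.V) = v
      rw [e.hom_inv_id]
      rfl
  apply hinj
  apply Prod.ext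
  · change ((e.hom ≫ prodObjFst X Y).hom.hom p : X.obj.V) = (e.hom ≫ prodObjFst X Y).hom.hom p'
    rw [hf]
    exact h₁
  · change ((e.hom ≫ prodObjSnd X Y).hom.hom p : Y.obj.V) = (e.hom ≫ prodObjSnd X Y).hom.hom p'
    rw [hs]
    exact h₂

/-- **Points of ANY limit binary fan: every pair is realised.** [cite: MochizukiSemiAnbd2006, Thm A.4 pp.82-86] -/
theorem exists_point_of_isLimit_binaryFan' {P : BTemp G} {fst : P ⟶ X} {snd : P ⟶ Y}
    (hP : IsLimit (BinaryFan.mk fst snd)) (x : X.obj.V) (y : Y.obj.V) :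
    ∃ p : P.obj.V, (fst.hom.hom p : X.obj.V) = x ∧ (snd.hom.hom p : Y.obj.V) = y := by
  let e : P ≅ prodObj X Y := hP.conePointUniqueUpToIso (isLimit_prodObj X Y)
  have h₁ : e.inv ≫ fst = prodObjFst X Y :=
    hP.conePointUniqueUpToIso_inv_comp (isLimit_prodObj X Y) ⟨WalkingPair.left⟩
  have h₂ : e.inv ≫ snd = prodObjSnd X Y :=
    hP.conePointUniqueUpToIso_inv_comp (isLimit_prodObj X Y) ⟨WalkingPair.right⟩
  refine ⟨e.inv.hom.hom (x, y), ?_, ?_⟩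
  · exact congrArg (fun φ : prodObj X Y ⟶ X => (φ.hom.hom (x, y) : X.obj.V)) h₁
  · exact congrArg (fun φ : prodObj X Y ⟶ Y => (φ.hom.hom (x, y) : Y.obj.V)) h₂

end BinaryFan



end BTemp

end Literature.AnabelianGeometry.SemiGraphs
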